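import Summits.MatrixMultiplication.OmegaCensus.STPPCertificate

/-!
# ω-census, family (b′): a kernel-evaluable STPP checker for explicit configurations

HONEST FRAMING (pub-omega census; verbatim): lottery ticket; floor = certified bounds/negative ranges.
Census bookkeeping, not progress on `ω` (the tree proves `ω < 2.373`; every bound obtainable from the
configurations this lane serves is `> 2.4`).

`STPPCertificate.lean` turns CKSU 2005 Thm. 5.5 into rows «configuration certified ⇒ `ω ≤ a/b`» whose only
non-arithmetic hypothesis is `IsSTPP A B C`.  For EXPLICIT configurations (the STPP-track census objects:
lists of elements of `ZMod n₁ × ⋯ × ZMod n_r`) the nine-quantifier predicate `IsSTPP` over `Finset`s is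
awkward for instance synthesis; this file provides the literal Boolean transcription `stppCheck` of
CKSU Def. 5.1 over LISTS, evaluable by `decide` in the kernel, the reflection lemma
`isSTPP_of_stppCheck`, and list-based forms of the two certificate theorems, so that a census row is
`stppCheck … = true` (kernel) + integer inequalities (kernel) and nothing else.  A worked instance
(CKSU Prop. 28 at `n = 5`, value `log 62.5/log 4 = 2.9829`) documents the shape; it is not a census row
(the family's optimum `n = 16` is the row `omega_le_of_localSUSP_w3_s2`).

References: H. Cohn, R. Kleinberg, B. Szegedy, C. Umans, FOCS 2005 (arXiv:math/0511460), Def. 5.1, Prop. 28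
(arXiv numbering; Prop. 5.2 of the proceedings), Thm. 5.5.
-/

open Literature.Computability.AlgebraicComplexity Finset

namespace Summit.MatrixMultiplication.OmegaCensus

/-- Literal Boolean transcription of CKSU 2005 Def. 5.1 in the tree's additive one-clause form `IsSTPP`,
for a configuration given by LISTS of elements: for all `i j k` and `s ∈ LA k, s' ∈ LA i, t ∈ LB i, t' ∈ LB j,
u ∈ LC j, u' ∈ LC k`, `(s'-s)+(t'-t)+(u'-u) = 0 → i = j ∧ j = k ∧ s = s' ∧ t = t' ∧ u = u'`.
[cite: CohnKleinbergSzegedyUmans2005, Def. 5.1] -/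
def stppCheck {H : Type*} [AddCommGroup H] [DecidableEq H] {N : ℕ} (LA LB LC : Fin N → List H) : Bool :=
  (List.finRange N).all fun i => (List.finRange N).all fun j => (List.finRange N).all fun k =>
    (LA k).all fun s => (LA i).all fun s' => (LB i).all fun t => (LB j).all fun t' =>
      (LC j).all fun u => (LC k).all fun u' =>
        decide ((s' - s) + (t' - t) + (u' - u) = 0 → i = j ∧ j = k ∧ s = s' ∧ t = t' ∧ u = u')

/-- **Reflection.** If the Boolean checker accepts the lists, the finsets they enumerate form an STPP
configuration (tree `IsSTPP`, CKSU 2005 Def. 5.1). [cite: CohnKleinbergSzegedyUmans2005, Def. 5.1] -/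
theorem isSTPP_of_stppCheck {H : Type*} [AddCommGroup H] [DecidableEq H] {N : ℕ}
    {LA LB LC : Fin N → List H} (h : stppCheck LA LB LC = true) :
    IsSTPP (fun i => (LA i).toFinset) (fun i => (LB i).toFinset) (fun i => (LC i).toFinset) := by
  intro i j k s hs s' hs' t ht t' ht' u hu u' hu' h0
  simp only [stppCheck, List.all_eq_true, decide_eq_true_eq] at h
  simp only [List.mem_toFinset] at hs hs' ht ht' hu hu'
  exact h i (List.mem_finRange i) j (List.mem_finRange j) k (List.mem_finRange k)
    s hs s' hs' t ht t' ht' u hu u' hu' h0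

/-- **Certificate → theorem for listed configurations, uniform volumes.** Lists `LA LB LC` accepted by
`stppCheck`, all of volume `|LA i| |LB i| |LC i| = V > 1` (as finsets), and `|H|^{3b} ≤ N^{3b} V^a` with `b > 0`
give `ω ≤ a/b` (CKSU Thm. 5.5 via `omega_le_div_of_isSTPP_uniform`).
[cite: CohnKleinbergSzegedyUmans2005, Thm. 5.5 and Def. 5.1] -/
theorem omega_le_div_of_stppCheck_uniform {H : Type} [AddCommGroup H] [Fintype H] [DecidableEq H] {N : ℕ}
    {LA LB LC : Fin N → List H} (hS : stppCheck LA LB LC = true) {V : ℕ}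
    (hV : ∀ i, (LA i).toFinset.card * (LB i).toFinset.card * (LC i).toFinset.card = V) (h1 : 1 < V)
    {a b : ℕ} (hb : 0 < b) (h : Fintype.card H ^ (3 * b) ≤ N ^ (3 * b) * V ^ a) :
    omega ℂ ≤ (a : ℝ) / (b : ℝ) :=
  omega_le_div_of_isSTPP_uniform (isSTPP_of_stppCheck hS) hV h1 hb h

/-- **Certificate → theorem for listed configurations, general volumes.** Lists accepted by `stppCheck`,
naturals `a, b, D > 0` and witnesses `q i` with `(q i)^{3b} ≤ D^{3b} Vᵢ^a` (`Vᵢ` the volume of triple `i` as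
finsets) and `D |H| < Σ q i` give `ω ≤ a/b` (CKSU Thm. 5.5 via `omega_le_div_of_isSTPP`).
[cite: CohnKleinbergSzegedyUmans2005, Thm. 5.5 and Def. 5.1] -/
theorem omega_le_div_of_stppCheck {H : Type} [AddCommGroup H] [Fintype H] [DecidableEq H] {N : ℕ}
    {LA LB LC : Fin N → List H} (hS : stppCheck LA LB LC = true) {a b D : ℕ} (ha : 0 < a) (hb : 0 < b)
    (hD : 0 < D) (q : Fin N → ℕ)
    (hq : ∀ i, q i ^ (3 * b) ≤
      D ^ (3 * b) * ((LA i).toFinset.card * (LB i).toFinset.card * (LC i).toFinset.card) ^ a)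
    (hsum : D * Fintype.card H < ∑ i, q i) :
    omega ℂ ≤ (a : ℝ) / (b : ℝ) :=
  omega_le_div_of_isSTPP (isSTPP_of_stppCheck hS) ha hb hD q hq hsum

/-! ## Worked instance (documentation of the row shape; not a census row) -/

/-- CKSU 2005 Prop. 28 at `n = 5`: the sets `Ĥ₁ = {(x,0,0) : x ≠ 0}`, `Ĥ₂`, `Ĥ₃` of `Cyc₅³` as lists. [folklore] -/
def cyc5Axis (c : Fin 3) : List (ZMod 5 × ZMod 5 × ZMod 5) :=
  (([1, 2, 3, 4] : List (ZMod 5))).map fun x =>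
    match c with
    | 0 => (x, 0, 0)
    | 1 => (0, x, 0)
    | 2 => (0, 0, x)

/-- Worked instance: the two triples `(Ĥ₁,Ĥ₂,Ĥ₃), (Ĥ₂,Ĥ₃,Ĥ₁)` in `Cyc₅³` pass `stppCheck` in the kernel
(CKSU Prop. 28, `n = 5`), have uniform volume `64`, and `125^3000 ≤ 2^3000 · 64^2983` certifies
`ω ≤ 2.983` (exact value of this configuration `log 62.5 / log 4 = 2.98289…`; the certificate is tight:
`a = 2982` fails). [cite: CohnKleinbergSzegedyUmans2005, Prop. 28 and Thm. 5.5] -/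
theorem omega_le_of_stpp_cyc5_prop28 : omega ℂ ≤ 2.983 := by
  have h := omega_le_div_of_stppCheck_uniform (H := ZMod 5 × ZMod 5 × ZMod 5) (N := 2)
    (LA := ![cyc5Axis 0, cyc5Axis 1]) (LB := ![cyc5Axis 1, cyc5Axis 2]) (LC := ![cyc5Axis 2, cyc5Axis 0])
    (by decide +kernel) (V := 64) (by decide +kernel) (by norm_num) (a := 2983) (b := 1000) (by norm_num)
    (by simp only [Fintype.card_prod, ZMod.card]; decide +kernel)
  have e : ((2983 : ℕ) : ℝ) / ((1000 : ℕ) : ℝ) = 2.983 := by norm_num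
  rwa [e] at h

/-! ## Quotient-set form of the checker (appended 2026-08-22, seat pub-omega-stpp-3)

For larger explicit objects the literal nine-quantifier checker is too slow for kernel evaluation at default
heartbeats (≈ 10⁵ innermost checks).  CKSU's own reformulation through quotient (difference) sets —
`x = s' - s ∈ A_i - A_k`, `y = t' - t ∈ B_j - B_i`, `z = u' - u ∈ C_k - C_j`, condition `x + y + z = 0` — lets the
kernel work on DEDUPLICATED difference lists: `stppCheckQ` below, with the reflection `isSTPP_of_stppCheckQ` and
the same two certificate wrappers.  (`s = s'` is recovered from `x = 0`, and `z = 0` from `x = y = 0`.) -/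

/-- Deduplicated list of differences `l - m`, `l ∈ L`, `m ∈ M` (the additive right-quotient set `L - M`). [folklore] -/
def diffList {H : Type*} [AddCommGroup H] [DecidableEq H] (L M : List H) : List H :=
  ((L.product M).map fun p => p.1 - p.2).dedup

/-- Membership in `diffList`: `a ∈ L`, `b ∈ M` give `a - b ∈ diffList L M`. [folklore] -/
theorem sub_mem_diffList {H : Type*} [AddCommGroup H] [DecidableEq H] {L M : List H} {a b : H}
    (ha : a ∈ L) (hb : b ∈ M) : a - b ∈ diffList L M := by
  simp only [diffList, List.mem_dedup, List.mem_map]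
  exact ⟨(a, b), by simp [ha, hb], rfl⟩

/-- Quotient-set form of the STPP checker (CKSU 2005 Def. 5.1 through difference sets): for all `i j k`,
all `x ∈ A_i - A_k`, `y ∈ B_j - B_i`: if `-(x + y) ∈ C_k - C_j` then `i = j`, `j = k`, `x = 0`, `y = 0`.
[cite: CohnKleinbergSzegedyUmans2005, Def. 5.1] -/
def stppCheckQ {H : Type*} [AddCommGroup H] [DecidableEq H] {N : ℕ} (LA LB LC : Fin N → List H) : Bool :=
  (List.finRange N).all fun i => (List.finRange N).all fun j => (List.finRange N).all fun k =>
    (diffList (LA i) (LA k)).all fun x => (diffList (LB j) (LB i)).all fun y =>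
      decide (-(x + y) ∈ diffList (LC k) (LC j) → i = j ∧ j = k ∧ x = 0 ∧ y = 0)

/-- **Reflection, quotient-set form.** If `stppCheckQ` accepts the lists, the finsets they enumerate form an
STPP configuration (tree `IsSTPP`). [cite: CohnKleinbergSzegedyUmans2005, Def. 5.1] -/
theorem isSTPP_of_stppCheckQ {H : Type*} [AddCommGroup H] [DecidableEq H] {N : ℕ}
    {LA LB LC : Fin N → List H} (h : stppCheckQ LA LB LC = true) :
    IsSTPP (fun i => (LA i).toFinset) (fun i => (LB i).toFinset) (fun i => (LC i).toFinset) := by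
  intro i j k s hs s' hs' t ht t' ht' u hu u' hu' h0
  simp only [stppCheckQ, List.all_eq_true, decide_eq_true_eq] at h
  simp only [List.mem_toFinset] at hs hs' ht ht' hu hu'
  have hz : u' - u = -((s' - s) + (t' - t)) := eq_neg_of_add_eq_zero_right h0
  have hzmem : -((s' - s) + (t' - t)) ∈ diffList (LC k) (LC j) := hz ▸ sub_mem_diffList hu' hu
  obtain ⟨hij, hjk, hx0, hy0⟩ := h i (List.mem_finRange i) j (List.mem_finRange j) k (List.mem_finRange k)
    (s' - s) (sub_mem_diffList hs' hs) (t' - t) (sub_mem_diffList ht' ht) hzmem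
  have hu0 : u' - u = 0 := by rw [hz, hx0, hy0, add_zero, neg_zero]
  exact ⟨hij, hjk, (sub_eq_zero.1 hx0).symm, (sub_eq_zero.1 hy0).symm, (sub_eq_zero.1 hu0).symm⟩

/-- **Certificate → theorem (quotient-set checker), uniform volumes.** As `omega_le_div_of_stppCheck_uniform`
with `stppCheckQ`. [cite: CohnKleinbergSzegedyUmans2005, Thm. 5.5 and Def. 5.1] -/
theorem omega_le_div_of_stppCheckQ_uniform {H : Type} [AddCommGroup H] [Fintype H] [DecidableEq H] {N : ℕ}
    {LA LB LC : Fin N → List H} (hS : stppCheckQ LA LB LC = true) {V : ℕ}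
    (hV : ∀ i, (LA i).toFinset.card * (LB i).toFinset.card * (LC i).toFinset.card = V) (h1 : 1 < V)
    {a b : ℕ} (hb : 0 < b) (h : Fintype.card H ^ (3 * b) ≤ N ^ (3 * b) * V ^ a) :
    omega ℂ ≤ (a : ℝ) / (b : ℝ) :=
  omega_le_div_of_isSTPP_uniform (isSTPP_of_stppCheckQ hS) hV h1 hb h

/-- **Certificate → theorem (quotient-set checker), general volumes.** As `omega_le_div_of_stppCheck` with
`stppCheckQ`. [cite: CohnKleinbergSzegedyUmans2005, Thm. 5.5 and Def. 5.1] -/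
theorem omega_le_div_of_stppCheckQ {H : Type} [AddCommGroup H] [Fintype H] [DecidableEq H] {N : ℕ}
    {LA LB LC : Fin N → List H} (hS : stppCheckQ LA LB LC = true) {a b D : ℕ} (ha : 0 < a) (hb : 0 < b)
    (hD : 0 < D) (q : Fin N → ℕ)
    (hq : ∀ i, q i ^ (3 * b) ≤
      D ^ (3 * b) * ((LA i).toFinset.card * (LB i).toFinset.card * (LC i).toFinset.card) ^ a)
    (hsum : D * Fintype.card H < ∑ i, q i) :
    omega ℂ ≤ (a : ℝ) / (b : ℝ) :=
  omega_le_div_of_isSTPP (isSTPP_of_stppCheckQ hS) ha hb hD q hq hsum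

end Summit.MatrixMultiplication.OmegaCensus
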